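import Mathlib.RingTheory.Nullstellensatz
import Mathlib.RingTheory.MvPolynomial.Homogeneous
import Mathlib.Geometry.Manifold.Complex
import Literature.Geometry.Kaehler.AnalyticSet
import HarnessLib

-- provenance: harness21/H21/H21/Statements/Hodge/ChowTheorem.lean @ 1293438 (interim HEAD d8f2665); M5 mechanical rewrite
/-!
# Chow's theorem in cone form (family `Hodge`, statement **hodge.S17**)

Informal target (**hodge.S17**): *Chow's theorem and GAGA — closed analytic subvarieties of a
projective variety are algebraic; analytic and algebraic coherent sheaves and their cohomology
correspond.* [W.-L. Chow, *On compact complex analytic varieties*, Amer. J. Math. **71** (1949),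
Thm. V; J.-P. Serre, *Géométrie algébrique et géométrie analytique*, Ann. Inst. Fourier **6**
(1956), Prop. 13 and Thms. 1–3.]

## What is stated here

Only the **Chow half**, and in its classical *affine cone* reformulation
[Griffiths–Harris, *Principles of Algebraic Geometry*, p. 167; Mumford, *Algebraic Geometry I:
Complex Projective Varieties*, §4B; Chirka, *Complex Analytic Sets*, §7.1]:

Let `V := Fin (n + 1) → ℂ = ℂⁿ⁺¹` with its Mathlib complex-manifold structure `𝓘(ℂ, V)`.
A subset `Z ⊆ V` is a *cone* (`Literature.AlgebraicGeometry.Motives.IsCone`) if it is stable under all scalars `c : ℂ`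
(including `c = 0`). Closed cones `Z ⊆ ℂⁿ⁺¹` correspond exactly to closed subsets of `ℙⁿ(ℂ)`
(via `Z ↦ (Z \ {0}) / ℂˣ`), closed cones which are complex-analytic *away from the vertex* `0`
correspond exactly to closed analytic subsets of `ℙⁿ(ℂ)`, and zero loci of homogeneous ideals
correspond to projective algebraic sets. Hence

* `Literature.AlgebraicGeometry.Motives.exists_ideal_eq_zeroLocus_of_isCone`: a closed cone in `ℂⁿ⁺¹` which is analytic on
  `{0}ᶜ` is the zero locus `MvPolynomial.zeroLocus ℂ I` of a polynomial ideal `I`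

is equivalent to "every closed analytic subset of `ℙⁿ(ℂ)` is algebraic", i.e. to Chow's theorem.
Analyticity **at** the vertex is deliberately *not* assumed: the statement with `IsAnalyticSet`
on all of `V` (recorded as the corollary
`Literature.AlgebraicGeometry.Motives.exists_ideal_eq_zeroLocus_of_isAnalyticSet_of_isCone`) is genuinely weaker as a
formal statement, since passing from "analytic off the vertex" to "analytic everywhere" is the
Remmert–Stein extension theorem, which is where the content of Chow's theorem lives.
We also record the refinement with finitely many *homogeneous* equations,
`Literature.AlgebraicGeometry.Motives.exists_finset_isHomogeneous_of_isCone`.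

## What is not stated (blocked)

* The projective-variety wording ("closed analytic subvarieties of a projective variety `X` are
  algebraic") needs the analytification functor `X ↦ Xᵃⁿ` from schemes of finite type over `ℂ`
  to complex-analytic spaces (inventory notion `analytification`, blocked [L]); moreover
  `ℙⁿ(ℂ)` is not yet a complex manifold (`ChartedSpace`/`IsManifold`) in Mathlib.
* The GAGA half (equivalence of categories of coherent algebraic and analytic sheaves on a
  projective variety, and comparison of their cohomology; Serre 1956, Thms. 1–3) needs coherent
  analytic sheaves and their cohomology (inventory notion `coherent_sheaf_gaga`, blocked
  [L, T-MOTIVE]).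

The skip list in the Wave-0 Hodge statement file is superseded by this header; that file is not
edited.

## Mathlib

`MvPolynomial.zeroLocus` (`Mathlib/RingTheory/Nullstellensatz.lean`) and
`MvPolynomial.IsHomogeneous` (`Mathlib/RingTheory/MvPolynomial/Homogeneous.lean`) are used as
is. Mathlib has no predicate for scalar-invariant subsets of a module (searched `IsCone`;
`ConvexCone`/`PointedCone` are real-convex notions and do not apply), so `IsCone` is a local
definition. Complex-analytic subsets come from `Literature.Prelude.Kaehler.AnalyticSet`
(`Literature.Geometry.Kaehler.IsAnalyticSetOn`, `Literature.Geometry.Kaehler.IsAnalyticSet`).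
-/

open scoped Manifold
open Set

namespace Literature.AlgebraicGeometry.Motives

section Hodge

variable {n : ℕ}

/-- `IsCone Z`: the subset `Z ⊆ ℂⁿ⁺¹` is a *cone* (with vertex `0`), i.e. it is stable under
multiplication by every scalar `c : ℂ`. The scalar `c = 0` is allowed, so a nonempty cone
contains the vertex `0`, and `∅` is a cone; both conventions are the right ones for Chow's
theorem (the empty projective variety is algebraic, and the affine cone over a nonempty
projective set contains `0`). [Griffiths–Harris, p. 167; Mumford, *Complex Projective
Varieties*, §4B; Chirka, §7.1] [folklore] -/
def IsCone (Z : Set (Fin (n + 1) → ℂ)) : Prop :=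
  ∀ (c : ℂ) (z : Fin (n + 1) → ℂ), z ∈ Z → c • z ∈ Z

/-- The empty set is a cone. [folklore] -/
theorem isCone_empty : IsCone (∅ : Set (Fin (n + 1) → ℂ)) := fun _ _ h => h

/-- The whole space is a cone. [folklore] -/
theorem isCone_univ : IsCone (univ : Set (Fin (n + 1) → ℂ)) := fun _ _ _ => mem_univ _

/-- A nonempty cone contains the vertex `0` (take `c = 0`). [folklore] -/
theorem IsCone.zero_mem {Z : Set (Fin (n + 1) → ℂ)} (hZ : IsCone Z) (hne : Z.Nonempty) :
    (0 : Fin (n + 1) → ℂ) ∈ Z := by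
  obtain ⟨z, hz⟩ := hne
  simpa using hZ 0 z hz

/-- A homogeneous polynomial of degree `d` satisfies `p (c • z) = c ^ d * p z`.
(Elementary; not found in Mathlib, searched `eval_smul` / `Homogeneous.lean`.) [folklore] -/
theorem eval_smul_of_isHomogeneous {σ : Type*} {p : MvPolynomial σ ℂ} {d : ℕ}
    (hp : p.IsHomogeneous d) (c : ℂ) (z : σ → ℂ) :
    MvPolynomial.eval (c • z) p = c ^ d * MvPolynomial.eval z p := by
  simp only [MvPolynomial.eval_eq, Finset.mul_sum]
  refine Finset.sum_congr rfl fun s hs => ?_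
  have hd : s.degree = d := by
    by_contra h
    exact (MvPolynomial.mem_support_iff.mp hs) (hp.coeff_eq_zero h)
  subst hd
  simp only [Pi.smul_apply, smul_eq_mul, mul_pow, Finset.prod_mul_distrib,
    Finset.prod_pow_eq_pow_sum, Finsupp.degree_apply]
  ring

/-- The zero locus of a finite family of homogeneous polynomials is a cone:
`p (c • z) = c ^ d * p z` for `p` homogeneous of degree `d`.
[Mumford, *Complex Projective Varieties*, §4B] [folklore] -/
theorem isCone_setOf_forall_eval_eq_zero (S : Finset (MvPolynomial (Fin (n + 1)) ℂ))
    (hS : ∀ p ∈ S, ∃ d, p.IsHomogeneous d) :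
    IsCone {z : Fin (n + 1) → ℂ | ∀ p ∈ S, MvPolynomial.eval z p = 0} := by
  intro c z hz p hp
  obtain ⟨d, hd⟩ := hS p hp
  rw [eval_smul_of_isHomogeneous hd, hz p hp, mul_zero]

/-- **hodge.S17** (Chow's theorem, cone form; Chow, Amer. J. Math. 71 (1949), Thm. V; Serre,
GAGA (1956), Prop. 13; cone reformulation: Griffiths–Harris p. 167, Mumford, *Complex Projective
Varieties* §4B, Chirka §7.1). A closed cone `Z ⊆ ℂⁿ⁺¹` which is a complex-analytic subset of
`ℂⁿ⁺¹ ∖ {0}` (i.e. analytic near every point other than the vertex) is *algebraic*: it is the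
common zero locus of an ideal of polynomials in `n + 1` variables. Equivalently, every closed
analytic subset of `ℙⁿ(ℂ)` is a projective algebraic set. Analyticity at the vertex is *not*
assumed (see the module docstring). [cite: GAGA1956] -/
def exists_ideal_eq_zeroLocus_of_isCone : Prop :=
  ∀ {Z : Set (Fin (n + 1) → ℂ)} (hZc : IsClosed Z) (hZ : IsCone Z) (hZa : Literature.Geometry.Kaehler.IsAnalyticSetOn 𝓘(ℂ, Fin (n + 1) → ℂ) Z {0}ᶜ),
    ∃ I : Ideal (MvPolynomial (Fin (n + 1)) ℂ), Z = MvPolynomial.zeroLocus ℂ I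

/-- **hodge.S17** (Chow's theorem, cone form with homogeneous equations; Chow 1949 Thm. V;
Serre, GAGA (1956), Prop. 13; Griffiths–Harris p. 167; Mumford, *Complex Projective Varieties*
§4B; Chirka §7.1). A closed cone `Z ⊆ ℂⁿ⁺¹` which is complex-analytic away from the vertex is
cut out by finitely many *homogeneous* polynomials: there is a finite set `S` of homogeneous
polynomials with `Z = {z | ∀ p ∈ S, p z = 0}`. (Finiteness is Hilbert's basis theorem;
homogeneity follows since the ideal of a cone is homogeneous.) [cite: Chow1949, Thm. V] -/
def exists_finset_isHomogeneous_of_isCone : Prop :=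
  ∀ {Z : Set (Fin (n + 1) → ℂ)} (hZc : IsClosed Z) (hZ : IsCone Z) (hZa : Literature.Geometry.Kaehler.IsAnalyticSetOn 𝓘(ℂ, Fin (n + 1) → ℂ) Z {0}ᶜ),
    ∃ S : Finset (MvPolynomial (Fin (n + 1)) ℂ), (∀ p ∈ S, ∃ d, p.IsHomogeneous d) ∧
      Z = {z | ∀ p ∈ S, MvPolynomial.eval z p = 0}

/-- **hodge.S17** (Chow's theorem, cone form, weaker corollary; Chow 1949 Thm. V; Serre, GAGA
(1956), Prop. 13; Griffiths–Harris p. 167). A cone `Z ⊆ ℂⁿ⁺¹` which is a (closed) analytic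
subset of all of `ℂⁿ⁺¹` — vertex included — is the zero locus of a polynomial ideal. This is
deduced from `exists_ideal_eq_zeroLocus_of_isCone` via `isAnalyticSet_iff_isClosed_and`. [cite: Chow1949, Thm. V] -/
def exists_ideal_eq_zeroLocus_of_isAnalyticSet_of_isCone : Prop :=
  ∀ {Z : Set (Fin (n + 1) → ℂ)} (hZ : Literature.Geometry.Kaehler.IsAnalyticSet 𝓘(ℂ, Fin (n + 1) → ℂ) Z) (hc : IsCone Z),
    ∃ I : Ideal (MvPolynomial (Fin (n + 1)) ℂ), Z = MvPolynomial.zeroLocus ℂ I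

/- interim proof relied on results that are now named facts (D-0014); demoted to a fact by the M5 import, proof preserved:
:=
  exists_ideal_eq_zeroLocus_of_isCone hZ.isClosed hc ((hZ.isAnalyticSetOn univ).mono
    (subset_univ _))
-/

end Hodge

end Literature.AlgebraicGeometry.Motives
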